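import Summits.CriticalPhenomena.SAWScalingLimit.Theorems.HexConjecture.Negative.NonVacuity
import Summits.CriticalPhenomena.SAWScalingLimit.Theorems.ObservableToSLER.Negative.RootPinNecessity
import Literature.Probability.RandomPlanarGeometry.SAWSideProbability

/-!
# `HexConjecture` — the literal (boundary-endpoint) reading is non-vacuous; refuted strengthenings

Support file for crux `stmt-CriticalPhenomena-0808` (cdisprove). (i) `HexConjectureBoundaryEndpoints`:
DCS 2012 Conjecture 1 with lattice endpoints restricted to discrete-BOUNDARY vertices of `Ω_δ` (the
printed setting; the crux is a priori stronger, `boundaryEndpoints_of_hexConjecture`); it is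
non-vacuous on the unit disc (`isEmbEndpointApprox_unitDisc_boundary`, zigzag exit witness) and
carries the same SLE_{8/3}-existence debt (`exists_isSLECurve_of_boundaryEndpoints`).
(ii) Refuted natural strengthenings: the laws are NOT probability measures for every `δ > 0`
(`meshBall_four_eq_empty`, `not_forall_isProbabilityMeasure_hexSAWLaw`), and the fugacity-`0`
version of the crux is false (`hexConjectureAtFugacity_zero_false`; `hexConjectureAtFugacity_critical`).
-/

noncomputable section

namespace Summit.CriticalPhenomena.SAWScalingLimit.Cruxes.HexConjecture.Boundary

open MeasureTheory Filter Topology Set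
open Literature.Probability.LatticeModels Literature.Probability.RandomPlanarGeometry
open Literature.Probability.RandomPlanarGeometry.SAW Literature.Probability.Process
open scoped NNReal ENNReal
open Summit.CriticalPhenomena.SAWScalingLimit.Cruxes.HexConjecture.Negative
open Summit.CriticalPhenomena.SAWScalingLimit.Cruxes.HexConjecture.NonVacuity

/-- A **discrete-boundary vertex of `Ω_δ`**: a vertex of `Ω_δ` having a honeycomb neighbour to
which the `Ω_δ`-edge is missing (the neighbour is outside `Ω_δ`, or the rescaled edge leaves `Ω̄`).
DCS's "`a_δ`, `b_δ` the vertices of `Ω_δ` closest to `a` and `b`" are such vertices. [folklore] -/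
def IsDiscreteBoundaryVertex (Ω : Set ℂ) (δ : ℝ) (v : HexVertex) : Prop :=
  v ∈ embMeshDomain hexGraph hexCenter Ω δ ∧ ∃ w, hexGraph.Adj v w ∧ ¬ (hexDomainGraph Ω δ).Adj v w

/-- **The printed conjecture, literal endpoint reading** (DCS 2012 Conj. 1 with boundary lattice
endpoints only): the crux restricted to approximations through discrete-boundary vertices. -/
def HexConjectureBoundaryEndpoints : Prop :=
  ∀ (D : DobrushinDomain) (a b : ℝ → HexVertex), IsEmbEndpointApprox hexGraph hexCenter D a b →
    (∀ᶠ δ in 𝓝[>] (0 : ℝ),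
      IsDiscreteBoundaryVertex D.carrier δ (a δ) ∧ IsDiscreteBoundaryVertex D.carrier δ (b δ)) →
    ConvergesInLawToSLE ((8 : ℝ≥0) / 3) D
      (fun δ (γ : HexDomainSAW D.carrier δ (a δ) (b δ)) => γ.curve)
      (fun δ => hexSAWLaw D.carrier δ (a δ) (b δ))

/-- The crux implies the literal (boundary-endpoint) reading. [folklore] -/
theorem boundaryEndpoints_of_hexConjecture (h : Theses.SAWDefectDecoherence.HexConjecture) :
    HexConjectureBoundaryEndpoints :=
  fun D a b happ _ => h D a b happ

section BoundaryWitness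

/-- The real-axis zigzag: `zig (2m) = (m,0;0)` (centre `m + 1/2 + i√3/6`), `zig (2m+1) = (m,0;1)`
(centre `m + 1 + i√3/3`). [folklore] -/
def zig (k : ℕ) : HexVertex := (![((k / 2 : ℕ) : ℤ), 0], if k % 2 = 0 then 0 else 1)

/-- Consecutive zigzag vertices are honeycomb neighbours. [folklore] -/
theorem zig_adj (k : ℕ) : hexGraph.Adj (zig k) (zig (k + 1)) := by
  rcases Nat.even_or_odd k with ⟨m, rfl⟩ | ⟨m, rfl⟩
  · have h1 : (m + m) % 2 = 0 := by omega
    have h2 : (m + m + 1) % 2 = 1 := by omega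
    have h3 : (m + m) / 2 = m := by omega
    have h4 : (m + m + 1) / 2 = m := by omega
    simp only [zig, h1, h2, h3, h4]
    exact hexGraph_adj_up m 0
  · have h1 : (2 * m + 1) % 2 = 1 := by omega
    have h2 : (2 * m + 1 + 1) % 2 = 0 := by omega
    have h3 : (2 * m + 1) / 2 = m := by omega
    have h4 : (2 * m + 1 + 1) / 2 = m + 1 := by omega
    simp only [zig, h1, h2, h3, h4]
    push_cast
    exact hexGraph_adj_e0 m 0

/-- Real part of the `k`-th zigzag centre: `(k + 1)/2`. [folklore] -/
theorem zig_re (k : ℕ) : (hexCenter (zig k)).re = ((k : ℝ) + 1) / 2 := by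
  rw [hexCenter_re_eq]
  rcases Nat.even_or_odd k with ⟨m, rfl⟩ | ⟨m, rfl⟩
  · have h1 : (m + m) % 2 = 0 := by omega
    have h3 : (m + m) / 2 = m := by omega
    simp [zig, h1, h3]; ring
  · have h1 : (2 * m + 1) % 2 = 1 := by omega
    have h3 : (2 * m + 1) / 2 = m := by omega
    simp [zig, h1, h3]; ring

/-- Imaginary part of the zigzag centres lies in `[√3/6, √3/3]`. [folklore] -/
theorem zig_im_mem (k : ℕ) :
    Real.sqrt 3 / 6 ≤ (hexCenter (zig k)).im ∧ (hexCenter (zig k)).im ≤ Real.sqrt 3 / 3 := by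
  rw [hexCenter_im_eq]
  have h3 : 0 ≤ Real.sqrt 3 := Real.sqrt_nonneg 3
  rcases Nat.even_or_odd k with ⟨m, rfl⟩ | ⟨m, rfl⟩
  · have h1 : (m + m) % 2 = 0 := by omega
    simp [zig, h1]
    constructor <;> nlinarith
  · have h1 : (2 * m + 1) % 2 = 1 := by omega
    simp [zig, h1]
    constructor <;> nlinarith

/-- Norm bounds of the zigzag centres: `(k+1)/2 ≤ ‖c‖ ≤ (k+1)/2 + √3/3`. [folklore] -/
theorem zig_norm_bounds (k : ℕ) :
    ((k : ℝ) + 1) / 2 ≤ ‖hexCenter (zig k)‖ ∧ ‖hexCenter (zig k)‖ ≤ ((k : ℝ) + 1) / 2 + Real.sqrt 3 / 3 := by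
  have hre := zig_re k
  obtain ⟨him1, him2⟩ := zig_im_mem k
  have h6 : 0 < Real.sqrt 3 / 6 := by positivity
  constructor
  · calc ((k : ℝ) + 1) / 2 = |(hexCenter (zig k)).re| := by rw [hre, abs_of_nonneg (by positivity)]
      _ ≤ _ := Complex.abs_re_le_norm _
  · calc ‖hexCenter (zig k)‖ ≤ |(hexCenter (zig k)).re| + |(hexCenter (zig k)).im| :=
          Complex.norm_le_abs_re_add_abs_im _
      _ ≤ ((k : ℝ) + 1) / 2 + Real.sqrt 3 / 3 := by
          rw [hre, abs_of_nonneg (by positivity), abs_of_nonneg (by linarith)]; linarith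

variable {δ : ℝ}

/-- For `δ > 0` the zigzag eventually leaves the disc of radius `δ⁻¹`. [folklore] -/
theorem exists_zig_out (hδ : 0 < δ) : ∃ k : ℕ, 1 ≤ δ * ‖hexCenter (zig k)‖ := by
  refine ⟨2 * ⌈δ⁻¹⌉₊, ?_⟩
  have h1 := (zig_norm_bounds (2 * ⌈δ⁻¹⌉₊)).1
  have h2 := one_le_mul_natCeil_inv hδ
  push_cast at h1
  nlinarith

open Classical in
/-- The index at which the zigzag first exits the disc of radius `δ⁻¹` (junk `0` for `δ ≤ 0`). -/
def kOut (δ : ℝ) : ℕ := if h : 0 < δ then Nat.find (exists_zig_out h) else 0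

/-- **Boundary endpoint near `+1`**: the last zigzag vertex inside the disc. -/
def aBd (δ : ℝ) : HexVertex := zig (kOut δ - 1)

/-- The exit vertex is outside the (open) disc. [folklore] -/
theorem one_le_kOut_norm (hδ : 0 < δ) : 1 ≤ δ * ‖hexCenter (zig (kOut δ))‖ := by
  classical
  rw [kOut, dif_pos hδ]
  exact Nat.find_spec (exists_zig_out hδ)

/-- The exit index is positive when `δ < 1` (the central vertex `zig 0` is inside). [folklore] -/
theorem kOut_pos (hδ : 0 < δ) (hδ1 : δ < 1) : 0 < kOut δ := by
  classical
  rw [kOut, dif_pos hδ, Nat.find_pos]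
  intro h0
  have hz : zig 0 = (![0, 0], 0) := by simp [zig]
  have hn : ‖hexCenter (zig 0)‖ < 1 := by rw [hz]; exact norm_lt_one_of_isCentral (Or.inl rfl)
  have : δ * ‖hexCenter (zig 0)‖ < 1 := mul_lt_one_of_nonneg_of_lt_one_left hδ.le hδ1 hn.le
  linarith

/-- `aBd δ` is INSIDE the disc (`0 < δ`, `0 < kOut δ`). [folklore] -/
theorem aBd_norm_lt (hδ : 0 < δ) (hk : 0 < kOut δ) : δ * ‖hexCenter (aBd δ)‖ < 1 := by
  classical
  have hfind : kOut δ = Nat.find (exists_zig_out hδ) := by rw [kOut, dif_pos hδ]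
  have hlt : kOut δ - 1 < Nat.find (exists_zig_out hδ) := by
    rw [← hfind]; exact Nat.sub_lt hk one_pos
  rw [aBd]
  exact not_le.1 (Nat.find_min (exists_zig_out hδ) hlt)

/-- `aBd δ` is a mesh vertex of the disc for `0 < δ < 1`. [folklore] -/
theorem aBd_mem (hδ : 0 < δ) (hδ1 : δ < 1) : aBd δ ∈ meshBall δ :=
  (mem_meshBall_iff hδ).2 (aBd_norm_lt hδ (kOut_pos hδ hδ1))

/-- `aBd δ` is adjacent to the exit vertex, which is NOT in `Ω_δ`: a discrete-boundary vertex. [folklore] -/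
theorem aBd_isDiscreteBoundaryVertex (hδ : 0 < δ) (hδ1 : δ < 1) :
    IsDiscreteBoundaryVertex (Metric.ball (0 : ℂ) 1) δ (aBd δ) := by
  refine ⟨(embMeshDomain_ball_eq hδ hδ1).symm ▸ aBd_mem hδ hδ1, zig (kOut δ), ?_, ?_⟩
  · have h := zig_adj (kOut δ - 1)
    rwa [Nat.sub_add_cancel (kOut_pos hδ hδ1)] at h
  · intro h
    have hmem := ((embDomainGraph_adj_iff hexGraph hexCenter).1 h).2.2
    have hout : zig (kOut δ) ∉ meshBall δ := by
      rw [mem_meshBall_iff hδ, not_lt]; exact one_le_kOut_norm hδ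
    exact hout (embMeshDomain_subset _ _ _ _ hmem)

/-- The real part of `δ · centre(aBd δ)` is squeezed in `[1 - δ(1/2 + √3/3), 1)`. [folklore] -/
theorem aBd_re_bounds (hδ : 0 < δ) (hδ1 : δ < 1) :
    1 - δ * (1 / 2 + Real.sqrt 3 / 3) ≤ δ * (hexCenter (aBd δ)).re ∧ δ * (hexCenter (aBd δ)).re < 1 := by
  have hk := kOut_pos hδ hδ1
  have hre : (hexCenter (aBd δ)).re = (kOut δ : ℝ) / 2 := by
    rw [aBd, zig_re]; push_cast [Nat.cast_sub hk]; ring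
  constructor
  · have h1 := one_le_kOut_norm hδ
    have h2 := (zig_norm_bounds (kOut δ)).2
    rw [hre]
    nlinarith
  · have h1 := aBd_norm_lt hδ hk
    have h2 : (((kOut δ - 1 : ℕ) : ℝ) + 1) / 2 ≤ ‖hexCenter (aBd δ)‖ := (zig_norm_bounds (kOut δ - 1)).1
    rw [hre]
    push_cast [Nat.cast_sub hk] at h2
    nlinarith [mul_le_mul_of_nonneg_left h2 hδ.le]

/-- `δ · centre(aBd δ) → 1`. [folklore] -/
theorem tendsto_aBd : Tendsto (fun δ : ℝ => (δ : ℂ) * hexCenter (aBd δ)) (𝓝[>] (0 : ℝ)) (𝓝 1) := by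
  have h0 : Tendsto (fun δ : ℝ => δ) (𝓝[>] (0 : ℝ)) (𝓝 0) :=
    tendsto_nhdsWithin_of_tendsto_nhds tendsto_id
  have hev : ∀ᶠ δ in 𝓝[>] (0 : ℝ), 0 < δ ∧ δ < 1 := Ioo_mem_nhdsGT one_pos
  -- real part → 1 by squeezing
  have hre : Tendsto (fun δ : ℝ => δ * (hexCenter (aBd δ)).re) (𝓝[>] (0 : ℝ)) (𝓝 1) := by
    have hlow : Tendsto (fun δ : ℝ => 1 - δ * (1 / 2 + Real.sqrt 3 / 3)) (𝓝[>] (0 : ℝ)) (𝓝 1) := by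
      simpa using (h0.mul_const (1 / 2 + Real.sqrt 3 / 3 : ℝ)).const_sub 1
    refine tendsto_of_tendsto_of_tendsto_of_le_of_le' hlow tendsto_const_nhds ?_ ?_
    · filter_upwards [hev] with δ hδ; exact (aBd_re_bounds hδ.1 hδ.2).1
    · filter_upwards [hev] with δ hδ; exact (aBd_re_bounds hδ.1 hδ.2).2.le
  -- imaginary part → 0
  have him : Tendsto (fun δ : ℝ => δ * (hexCenter (aBd δ)).im) (𝓝[>] (0 : ℝ)) (𝓝 0) := by
    have hup : Tendsto (fun δ : ℝ => δ * (Real.sqrt 3 / 3)) (𝓝[>] (0 : ℝ)) (𝓝 0) := by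
      simpa using h0.mul_const (Real.sqrt 3 / 3 : ℝ)
    refine tendsto_of_tendsto_of_tendsto_of_le_of_le' tendsto_const_nhds hup ?_ ?_
    · filter_upwards [hev] with δ hδ
      have := (zig_im_mem (kOut δ - 1)).1
      exact mul_nonneg hδ.1.le (by rw [aBd]; linarith [Real.sqrt_nonneg 3])
    · filter_upwards [hev] with δ hδ
      exact mul_le_mul_of_nonneg_left (zig_im_mem (kOut δ - 1)).2 hδ.1.le
  have h3 := ((Complex.continuous_ofReal.tendsto 1).comp hre).add
    (((Complex.continuous_ofReal.tendsto 0).comp him).mul_const Complex.I)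
  simp only [Function.comp_def, Complex.ofReal_one, Complex.ofReal_zero, zero_mul, add_zero] at h3
  refine h3.congr' (Eventually.of_forall fun δ => ?_)
  apply Complex.ext <;> simp

/-- The reflection `re ↦ -re` of the honeycomb lattice: `(x₀, x₁; t) ↦ (-x₀ - x₁ - 1 - t, x₁; t)`. [folklore] -/
def reflV (v : HexVertex) : HexVertex := (![-v.1 0 - v.1 1 - 1 - (v.2 : ℕ), v.1 1], v.2)

/-- The reflection acts on centres by `z ↦ -conj z`. [folklore] -/
theorem hexCenter_reflV (v : HexVertex) : hexCenter (reflV v) = -(starRingEnd ℂ) (hexCenter v) := by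
  apply Complex.ext
  · rw [hexCenter_re_eq, Complex.neg_re, Complex.conj_re, hexCenter_re_eq]
    simp [reflV]; ring
  · rw [hexCenter_im_eq, Complex.neg_im, Complex.conj_im, hexCenter_im_eq]
    simp [reflV]

/-- The reflection preserves norms of centres. [folklore] -/
theorem norm_hexCenter_reflV (v : HexVertex) : ‖hexCenter (reflV v)‖ = ‖hexCenter v‖ := by
  rw [hexCenter_reflV, norm_neg, Complex.norm_conj]

/-- The reflection is a graph automorphism of `ℍ` (adjacency is preserved). [folklore] -/
theorem reflV_adj {v w : HexVertex} (h : hexGraph.Adj v w) : hexGraph.Adj (reflV v) (reflV w) := by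
  obtain ⟨x, t⟩ := v
  obtain ⟨y, s⟩ := w
  have key := (hexGraph_adj_iff_coord x y t s).1 h
  refine (hexGraph_adj_iff_coord _ _ t s).2 ?_
  fin_cases t <;> fin_cases s <;> simp at key ⊢ <;> omega

/-- **Boundary endpoint near `-1`**: the mirror image of `aBd δ`. -/
def bBd (δ : ℝ) : HexVertex := reflV (aBd δ)

/-- `bBd δ` is a mesh vertex of the disc for `0 < δ < 1`. [folklore] -/
theorem bBd_mem (hδ : 0 < δ) (hδ1 : δ < 1) : bBd δ ∈ meshBall δ := by
  rw [mem_meshBall_iff hδ, bBd, norm_hexCenter_reflV]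
  exact (mem_meshBall_iff hδ).1 (aBd_mem hδ hδ1)

/-- `bBd δ` is a discrete-boundary vertex of `Ω_δ` (mirror image of the exit edge). [folklore] -/
theorem bBd_isDiscreteBoundaryVertex (hδ : 0 < δ) (hδ1 : δ < 1) :
    IsDiscreteBoundaryVertex (Metric.ball (0 : ℂ) 1) δ (bBd δ) := by
  refine ⟨(embMeshDomain_ball_eq hδ hδ1).symm ▸ bBd_mem hδ hδ1, reflV (zig (kOut δ)), ?_, ?_⟩
  · have h := zig_adj (kOut δ - 1)
    rw [Nat.sub_add_cancel (kOut_pos hδ hδ1)] at h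
    exact reflV_adj h
  · intro h
    have hmem := ((embDomainGraph_adj_iff hexGraph hexCenter).1 h).2.2
    have hout : reflV (zig (kOut δ)) ∉ meshBall δ := by
      rw [mem_meshBall_iff hδ, not_lt, norm_hexCenter_reflV]; exact one_le_kOut_norm hδ
    exact hout (embMeshDomain_subset _ _ _ _ hmem)

/-- `δ · centre(bBd δ) → -1`. [folklore] -/
theorem tendsto_bBd : Tendsto (fun δ : ℝ => (δ : ℂ) * hexCenter (bBd δ)) (𝓝[>] (0 : ℝ)) (𝓝 (-1)) := by
  have hc : Continuous fun z : ℂ => -(starRingEnd ℂ) z := continuous_neg.comp Complex.continuous_conj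
  have h := (hc.tendsto 1).comp tendsto_aBd
  simp only [Function.comp_def, map_one] at h
  refine h.congr' (Eventually.of_forall fun δ => ?_)
  beta_reduce
  rw [bBd, hexCenter_reflV, map_mul, Complex.conj_ofReal]; ring

/-- **The boundary-endpoint approximation of `(𝔻; 1, -1)`.** [folklore] -/
theorem isEmbEndpointApprox_unitDisc_boundary :
    IsEmbEndpointApprox hexGraph hexCenter DobrushinDomain.unitDisc aBd bBd where
  reachable := by
    filter_upwards [Ioo_mem_nhdsGT (one_pos : (0 : ℝ) < 1)] with δ hδ
    exact hexDomainGraph_ball_reachable hδ.1 hδ.2 (aBd_mem hδ.1 hδ.2) (bBd_mem hδ.1 hδ.2)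
  tendsto_fst := by rw [Literature.Probability.Percolation.unitDisc_pt_zero]; exact tendsto_aBd
  tendsto_snd := by rw [unitDisc_pt_one]; exact tendsto_bBd

/-- … whose endpoints are eventually discrete-BOUNDARY vertices (DCS's literal setting). [folklore] -/
theorem eventually_isDiscreteBoundaryVertex_aBd_bBd :
    ∀ᶠ δ in 𝓝[>] (0 : ℝ), IsDiscreteBoundaryVertex DobrushinDomain.unitDisc.carrier δ (aBd δ) ∧
      IsDiscreteBoundaryVertex DobrushinDomain.unitDisc.carrier δ (bBd δ) := by
  filter_upwards [Ioo_mem_nhdsGT (one_pos : (0 : ℝ) < 1)] with δ hδ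
  exact ⟨aBd_isDiscreteBoundaryVertex hδ.1 hδ.2, bBd_isDiscreteBoundaryVertex hδ.1 hδ.2⟩

/-- **The repair `C′` carries the same existence debt**: already the literal (boundary-endpoint)
reading yields an SLE_{8/3} random curve in the unit disc (instance of the unproved `exists_isSLECurve`). [folklore] -/
theorem exists_isSLECurve_of_boundaryEndpoints (h : HexConjectureBoundaryEndpoints) :
    ∃ Γ, IsSLECurve ((8 : ℝ≥0) / 3) DobrushinDomain.unitDisc Γ := by
  obtain ⟨Γ, hΓ, -, -⟩ := h DobrushinDomain.unitDisc aBd bBd isEmbEndpointApprox_unitDisc_boundary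
    eventually_isDiscreteBoundaryVertex_aBd_bBd
  exact ⟨Γ, hΓ⟩

end BoundaryWitness

section Strengthenings

/-- Every face centre has `|im| ≥ √3/6`: `im = B·√3/6` with `B = 3x₁ + t + 1 ≢ 0 (mod 3)`. [folklore] -/
theorem sqrt_three_div_six_le_abs_im (v : HexVertex) : Real.sqrt 3 / 6 ≤ |(hexCenter v).im| := by
  rw [hexCenter_im_eq]
  have hB : (1 : ℝ) ≤ |((3 * v.1 1 + (v.2 : ℕ) + 1 : ℤ) : ℝ)| := by
    have : (3 * v.1 1 + (v.2 : ℕ) + 1 : ℤ) ≠ 0 := by have := v.2.isLt; omega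
    rw [← Int.cast_abs]
    exact_mod_cast Int.one_le_abs this
  have h3 : 0 < Real.sqrt 3 := Real.sqrt_pos.2 (by norm_num)
  rw [show ((v.1 1 : ℝ) + (((v.2 : ℕ) : ℝ) + 1) / 3) * (Real.sqrt 3 / 2) =
    ((3 * v.1 1 + (v.2 : ℕ) + 1 : ℤ) : ℝ) * (Real.sqrt 3 / 6) by push_cast; ring, abs_mul,
    abs_of_pos (by positivity : (0 : ℝ) < Real.sqrt 3 / 6)]
  nlinarith

/-- Hence every face centre has norm `≥ √3/6 > 1/4`. [folklore] -/
theorem norm_hexCenter_gt_quarter (v : HexVertex) : 1 / 4 < ‖hexCenter v‖ := by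
  have h1 := sqrt_three_div_six_le_abs_im v
  have h2 := Complex.abs_im_le_norm (hexCenter v)
  have h3 : (3 / 2 : ℝ) < Real.sqrt 3 := by
    rw [show (3 / 2 : ℝ) = Real.sqrt (9 / 4) by
      rw [show (9 / 4 : ℝ) = (3 / 2) ^ 2 by norm_num, Real.sqrt_sq (by norm_num)]]
    exact Real.sqrt_lt_sqrt (by norm_num) (by norm_num)
  linarith

/-- **At mesh `δ = 4` the discretisation of the unit disc is EMPTY** (no face centre has norm
`< 1/4`). [folklore] -/
theorem meshBall_four_eq_empty : meshBall 4 = ∅ := by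
  ext v
  simp only [Set.mem_empty_iff_false, iff_false]
  rw [mem_meshBall_iff (by norm_num : (0 : ℝ) < 4)]
  have := norm_hexCenter_gt_quarter v
  intro h
  linarith

/-- `aIn δ ≠ bIn δ` (parity of `2⌈δ⁻¹⌉₊ ≠ 5`). [folklore] -/
theorem aIn_ne_bIn (δ : ℝ) : aIn δ ≠ bIn δ := by
  intro h
  have h' := congrArg (fun v : HexVertex => v.1 0) h
  simp [aIn, bIn, vOut] at h'
  omega

/-- **Strengthening 1 refuted — "eventually" cannot be dropped.** Even for the genuine endpoint
approximation `(aIn, bIn)`, `hexSAWLaw 𝔻 δ (aIn δ) (bIn δ)` is NOT a probability measure for every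
`δ > 0`: at `δ = 4` it is the junk zero measure (the `∀ᶠ δ` in clause (i) is essential). [folklore] -/
theorem not_forall_isProbabilityMeasure_hexSAWLaw :
    ¬ ∀ δ : ℝ, 0 < δ → IsProbabilityMeasure (hexSAWLaw (Metric.ball (0 : ℂ) 1) δ (aIn δ) (bIn δ)) := by
  intro h
  have h4 := h 4 (by norm_num)
  have hmem : (4 : ℝ) * hexCenter (aIn 4) ∉ Metric.ball (0 : ℂ) 1 := by
    have : aIn 4 ∉ meshBall 4 := by rw [meshBall_four_eq_empty]; exact fun h => h
    simpa [mem_embMeshVertices_iff] using this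
  have h0 : hexSAWLaw (Metric.ball (0 : ℂ) 1) 4 (aIn 4) (bIn 4) = 0 :=
    hexSAWLaw_eq_zero_of_not_mem hmem (aIn_ne_bIn 4)
  have := h4.measure_univ
  rw [h0] at this
  simp at this

/-- The crux at a general fugacity `x` (the weight `x^{ℓ(γ)}`, normalised). -/
def HexConjectureAtFugacity (x : ℝ) : Prop :=
  ∀ (D : DobrushinDomain) (a b : ℝ → HexVertex), IsEmbEndpointApprox hexGraph hexCenter D a b →
    ConvergesInLawToSLE ((8 : ℝ≥0) / 3) D
      (fun δ (γ : HexDomainSAW D.carrier δ (a δ) (b δ)) => γ.curve)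
      (fun δ => embLaw hexGraph hexCenter D.carrier δ x (a δ) (b δ))

/-- At `x = x_c` this is the crux, definitionally. [folklore] -/
theorem hexConjectureAtFugacity_critical :
    HexConjectureAtFugacity hexCriticalFugacity ↔ Theses.SAWDefectDecoherence.HexConjecture :=
  Iff.rfl

/-- At fugacity `0` every SAW has weight `0^{ℓ} = 0` (`ℓ ≥ 1` vertices): the weight measure vanishes … [folklore] -/
theorem embWeight_fugacity_zero {V : Type*} (G : SimpleGraph V) (emb : V → ℂ) (Ω : Set ℂ) (δ : ℝ)
    (a b : V) : embWeight G emb Ω δ 0 a b = 0 := by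
  rw [embWeight]
  have h : (fun γ : EmbDomainSAW G emb Ω δ a b =>
      ENNReal.ofReal ((0 : ℝ) ^ γ.vertexCount) • Measure.dirac γ) = fun _ => 0 := by
    funext γ
    rw [EmbDomainSAW.vertexCount, zero_pow (Nat.succ_ne_zero _), ENNReal.ofReal_zero, zero_smul]
  rw [h, Measure.sum_zero]

/-- … so the "law" at fugacity `0` is the junk zero measure, for every domain, mesh and endpoints. [folklore] -/
theorem embLaw_fugacity_zero {V : Type*} (G : SimpleGraph V) (emb : V → ℂ) (Ω : Set ℂ) (δ : ℝ)
    (a b : V) : embLaw G emb Ω δ 0 a b = 0 := by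
  rw [embLaw, embWeight_fugacity_zero, smul_zero]

/-- **Strengthening 2 refuted — positivity of the fugacity is used.** The fugacity-`0` version of
the crux is false (given only `isProjectiveLimit_preWienerMeasure`): its laws are identically zero,
tested against the genuine approximation `(aIn, bIn)`; the crux sits at `x_c ∈ (0, 1)`. (The regimes
`0 < x ≠ x_c` are beyond cheap refutation here.) [folklore] -/
theorem hexConjectureAtFugacity_zero_false (hW : isProjectiveLimit_preWienerMeasure) :
    ¬ HexConjectureAtFugacity 0 := by
  intro h
  obtain ⟨Γ, -, -, hlaw⟩ := h DobrushinDomain.unitDisc aIn bIn isEmbEndpointApprox_unitDisc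
  haveI := isProbabilityMeasure_preWienerMeasure hW
  have h1 := hlaw (BoundedContinuousFunction.const _ 1)
  simp only [BoundedContinuousFunction.const_apply, integral_const, smul_eq_mul, mul_one,
    probReal_univ] at h1
  have h2 : Tendsto (fun δ => (embLaw hexGraph hexCenter DobrushinDomain.unitDisc.carrier δ 0 (aIn δ)
      (bIn δ)).real univ) (𝓝[>] (0 : ℝ)) (𝓝 0) := by
    refine tendsto_const_nhds.congr' (Eventually.of_forall fun δ => ?_)
    beta_reduce
    rw [embLaw_fugacity_zero, measureReal_zero_apply]
  have := tendsto_nhds_unique h1 h2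
  norm_num at this

end Strengthenings
end Summit.CriticalPhenomena.SAWScalingLimit.Cruxes.HexConjecture.Boundary
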